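import Summits.FinalStateConjecture.FinalStateConjecture.Theses.EIHFluxBalance
import Summits.FinalStateConjecture.FinalStateConjecture.Theorems.InertialRecession.Negative.KinematicShadow
import Summits.FinalStateConjecture.FinalStateConjecture.Theorems.InertialRecession.Negative.PaintingRigidityStabiliser

/-!
# Line `sublinear-is-free-clean-window-charges` — skeleton for the crux `InertialRecession`
# (item stmt-FinalStateConjecture-10166, route `EIHFluxBalance`) — LEAD RESHAPE r2 (2026-08-16)

Planner skeleton: `planner-cruxplan-stmt-FinalStateConjecture-10166-sublinear-is-free-cl-0` (round 1, 6 stubs).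
Lead: `prover-line-stmt-FinalStateConjecture-10166-0`. Cards: `Ideas/sublinear-is-free-clean-window-charges.md`,
`Lines/sublinear-is-free-clean-window-charges.md`, `PICKED.md`.

## The line in one paragraph (unchanged idea)

The Statement's `FinalStateDecomposition` fixes only the LABELS `(Λᵢ, cᵢ)`, tests `C²` convergence in FREE charts on
truncated slabs, and lets the flat domain be anything containing the complement of round tubes of ANY sublinear radius. So
the crux follows from (i) SLAVING of the painted moduli (rates of `uᵢ = Λᵢe₀`, of the centre mismatch `ξ̇ᵢ − v(Λᵢ)` and, for
`aᵢ ≠ 0`, of the axis `Λᵢe₃` vanish — stated MODULO the Kerr–Schild stabiliser, cf. `Negative/PaintingRigidityStabiliser`),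
(ii) CESÀRO velocities `ξᵢ(t)/t → Vᵢ`, and (iii) re-charting. Cesàro velocities are read RATE-FREE from the Landau–Lifshitz
surface charges of the TRUE lab metric on δ-clear coordinate spheres ("windows") at every scale above a slowly growing
threshold `ρ(t) → ∞`: there the crux's own weight `1 + d^{7/4}` plus quasi-stationarity of the modulated background make the
flux through a window of radius `R` at most `C R^{-3/2}` POINTWISE IN TIME (quadratic LL flux × area:
`M²R⁻² + εMR^{-7/4} + ε²R^{-3/2}`), which is integrable along every path `R ≍ t^θ`, `θ > 2/3`, and is a usable IMPULSE BOUND at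
every smaller scale. The parabolic obstruction (`Disproof.quadraticRemainder_not_integrable`) is never met: no per-hole
momentum is ever claimed to converge at scales `≤ t^{2/3}`; the endgame needs only (a) convergence of CLUSTER charges at scale
`≍ t` and (b) equalisation of velocities inside a cluster, which the impulse bound gives by a bootstrap ("two members with
relative speed `w₀` at distance `d` separate to `λd` within time `λd/w₀`, during which the impulse is `≲ d^{-1/2}/w₀ → 0`").

## Reshape r2 (lead) — what changed against the planner's round-1 skeleton and why

* Every registered stub is now SELF-CONTAINED (no local `def … : Prop` in a signature), so that a Theorems-side proof can
  restate it verbatim (the gate matches `--supports` proposals to registered stubs by name + signature, and Prop-valued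
  definitions are not allowed under `Summits/`).
* `Slaved` is THIRD order (rates of `Λe₀` and of the axis up to order 3, of the mismatch up to order 2): the `C²` convergence of
  the re-charted metric in `stub_rechart` differentiates the chart map three times (lead analysis F2 in NOTES.md); the `C³`
  hypothesis controls `Ric(G(λ(·)))` in `C¹`, which is exactly this jet. `stub_slaving` also exports the two kinematic facts about
  painted velocities the endgame consumes (continuity; a uniform bound `k < 1` from the Lorentz-factor clause).
* The planner's `stub_cleanWindow` + `stub_cesaroOfCleanWindow` both silently needed charge IDENTIFICATION (`P ≈ ΣMγ(1,v)`),
  which no hypothesis supplied. They are replaced by `stub_chargeModel` (GR: the abstract WINDOW LAW and IDENTIFICATION for the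
  LL charges of the lab metric, at all scales above any `ρ → ∞`) and `stub_cesaroEndgame` (Mathlib-only real analysis: abstract
  charges ⇒ Cesàro velocities; the clean-window / cluster combinatorics lives inside its proof). The lead holds the endgame.
* LL (96.8)/(96.9) — "the densitised pseudotensor is a quadratic form in `∂g`" — is isolated as `stub_pseudotensorBound`
  (the tree DEFINES `pseudotensor := (−g)⁻¹Σ∂h − G/8π`; the quadratic structure is the one library theorem every charge-based
  line needs), and `stub_windowCharges` is the QUANTITATIVE moving-sphere law conditional on it.

## Stubs (7) and composition

* `stub_slaving`             K1  — antecedent ⇒ Slaved³ ∧ painted-velocity kinematics.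
* `stub_quasiStationarity`   K3′ — antecedent + Slaved³ ⇒ `(1 + d^{7/4})‖∂ₜG(λ(t))‖ → 0` off tubes of any radius `ρ(t) → ∞`.
* `stub_pseudotensorBound`   LL  — `|(−g) t^{μν}_LL(x)| ≤ C‖∂g(x)‖²` when `‖g(x) − η‖ ≤ 1/2` (LL (96.9), bound form).
* `stub_windowCharges`       K3  — pseudotensor bound ⇒ `|P(t₂) − P(t₁)| ≤ C∫R²b²` along `C¹` moving vacuum spheres.
* `stub_chargeModel`         K2a — window charges + antecedent + Slaved³ + quasi-stationarity ⇒ abstract WINDOW LAW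
                                    (`|ΔP| ≤ C∫R^{-3/2}` on 2-Lipschitz δ-admissible window paths above `ρ`) and IDENTIFICATION
                                    (`P(window) = Σ_{members} Mⱼγⱼ(1,vⱼ) + ζ(t)`, `ζ → 0`) for `P = quasiLocalMomentum(labMetric)`.
* `stub_cesaroEndgame`       K2b — (Mathlib only) kinematics + abstract slaving + window law + identification ⇒ Cesàro
                                    velocities (lead's stub; `N ≤ 2` by the bootstrap above, general `N` by induction on clusters).
* `stub_rechart`             P2  — antecedent + Slaved³ + Cesàro velocities ⇒ the crux conclusion (hole charts
                                    `ψᵢ(y) = (Tᵢ(y), ξᵢ(Tᵢ) + Sᵢ(Tᵢ)z̲′(y))` whose `{r = r₊}` IS the painted horizon, so horizon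
                                    normalisation is inherited from the hypothesis' exhaustion clause — lead analysis F1).
* `InertialRecession_of : InertialRecession` — the composition (no `sorry` of its own).

## Disproof.lean obligations honoured (as in round 1)

`inertialRecession_false_without_fieldEquations` / `_cesaro` (§C/§G): the field equations enter through `𝒟` in `stub_slaving`,
`stub_quasiStationarity` and `stub_chargeModel` (`Ric(Φ^*g) = 0` on the windows); the endgame derives nothing from kinematics alone
(its charges are hypotheses the §C witness violates: an isolated hole's charge `Mγ(1,v)` with `v = cos log`-type wandering is not
quasi-conserved at scale `t`). §D evaded (no per-hole momentum limit below scale `t`). §H (`CleanScaleCesaro`, p = 3/2 > 1) is the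
same exponent as the window law's `R^{-3/2}`. `PaintingRigidityStabiliser`: no stub bounds `deriv Λᵢ`; only `Λᵢe₀`, `Λᵢe₃`
(`aᵢ ≠ 0`), `ξᵢ`, the background FIELD and the LAB METRIC appear — all twist-invariant (kernel checks at the end of the file).
-/

set_option linter.dupNamespace false

noncomputable section

namespace Summit.FinalStateConjecture.FinalStateConjecture.Cruxes.InertialRecession.SublinearIsFreeCleanWindowCharges

open scoped BigOperators Topology Manifold Classical MeasureTheory Matrix InnerProductSpace ContDiff ENNReal
open Filter Set Function TopologicalSpace MeasureTheory Literature.Geometry.Lorentzian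
open Summit.FinalStateConjecture.FinalStateConjecture.Theses.EIHFluxBalance

/-! ## The stubs (registered; every signature self-contained) -/

/-- **K1 · SLAVING, third order (modulo the Kerr–Schild stabiliser), plus painted-velocity kinematics.** Under the crux
antecedent, for every hole `i`: the painted 4-velocity `uᵢ(t) = Λᵢ(t)e₀` has lab-time derivatives of orders `1, 2, 3`
tending to `0`; the centre mismatch `ξ̇ᵢ(t) − v(Λᵢ(t))`, `v(Λ) = (Λe₀)̲/(Λe₀)⁰`, and its first two derivatives tend to
`0`; when `aᵢ ≠ 0` the painted axis `Λᵢ(t)e₃` has derivatives of orders `1, 2, 3` tending to `0` (nothing is claimed about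
`deriv Λᵢ` itself: false in general, `Negative/PaintingRigidityStabiliser`). Mechanism: `Ric(Φ^*g) = 0` and `C³`-closeness
on whole lab slabs reaching inside the horizons give `Ric(G(λ(·))) → 0` in `C¹` on each near annulus; the tidal part is
`O(Mⱼ/Dᵢⱼ) → 0`; the remainder is linear in the parameter jet with explicit Kerr–Schild coefficient fields, injective modulo
the Killing directions (kit j005733 at `a = 0`), after an a-priori bound on the jet extracted from the `m ≤ 3` clauses.
KINEMATICS (easy part): `t ↦ v(Λᵢ(t))` is continuous (`Λᵢ` smooth, `|(Λe₀)⁰| ≥ 1`) and `‖v(Λᵢ(t))‖ ≤ k := √(1 − γ⁻²) < 1`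
from the Lorentz-factor clause `|(Λᵢe₀)⁰| ≤ γ` and `η(Λe₀, Λe₀) = −1`. Size L/XL.
[arXiv:0806.3293; doi:10.1093/oso/9780198514794.003.0004; LL §96; landed `Theorems.EIHFluxBalanceInertialRecessionLorentz`] -/
theorem stub_slaving : ∀ (X : Type) [TopologicalSpace X] [ChartedSpace E3 X] [IsManifold (𝓡 3) ((⊤ : ℕ∞) : WithTop ℕ∞) X] [T2Space X] [SecondCountableTopology X] [ConnectedSpace X], ∀ D ∈ admissibleVacuumData X, ∀ 𝒟 : VacuumCauchyDevelopment D, 𝒟.IsMaximal → ∀ (N : ℕ) (M a rin : Fin N → ℝ) (Λ : Fin N → ℝ → lorentzGroup) (ξ : Fin N → ℝ → E3) (γ κ τ₀ : ℝ) (U : Opens E4) (Φ : U → 𝒟.carrier) (O : Set 𝒟.carrier), ((∀ i, Kerr.IsSubextremal (M i) (a i) ∧ Kerr.rMinus (M i) (a i) < rin i ∧ rin i < Kerr.rPlus (M i) (a i)) ∧ (∀ i t, |((Λ i t : E4 ≃L[ℝ] E4) (E4.basisVector 0)) 0| ≤ γ) ∧ (∀ i, ContDiff ℝ ((⊤ :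 ℕ∞) : WithTop ℕ∞) (ξ i) ∧ ContDiff ℝ ((⊤ : ℕ∞) : WithTop ℕ∞) (fun t ↦ ((Λ i t : E4 ≃L[ℝ] E4) : E4 →L[ℝ] E4))) ∧ (∀ i j, i ≠ j → Tendsto (fun t ↦ ‖ξ i t - ξ j t‖) atTop atTop) ∧ (0 < κ ∧ κ < 1 ∧ ∀ i, ∀ᶠ t in atTop, ‖ξ i t‖ ≤ κ ^ 2 * t) ∧ ({x : E4 | τ₀ < x 0 ∧ ∀ i, rin i < Kerr.radius (a i) (poincareInv (Λ i (x 0)) (E4.ofTimeSpace (x 0) (ξ i (x 0))) x)} ⊆ (U : Set E4)) ∧ let B : ModelBackground := ⟨U, fun x ↦ Minkowski.bilin + ∑ i, (boostedKerrBilin (Λ i (x 0)) (E4.ofTimeSpace (x 0) (ξ i (x 0))) (M i) (a i) x - Minkowski.bilin), fun x ↦ x 0, E4.spatialNorm⟩; ContMDiff 𝓘(ℝ, E4) (𝓡 4) ((⊤ : ℕ∞) : WithTop ℕ∞) Φ ∧ Topology.IsOpenEmbedding ((B.lateRegion τ₀).restrict Φ) ∧ Φ '' {x : U | τ₀ < x.1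 0 ∧ ∀ i, Kerr.rPlus (M i) (a i) < Kerr.radius (a i) (poincareInv (Λ i (x.1 0)) (E4.ofTimeSpace (x.1 0) (ξ i (x.1 0))) x.1)} ⊆ O ∧ Tendsto (fun t ↦ 𝒟.toSpacetime.deviationCk B Φ 3 t) atTop (𝓝 0) ∧ Tendsto (fun t : ℝ ↦ ⨆ x ∈ {x : U | x.1 0 = t ∧ E4.spatialNorm x.1 ≤ κ * t}, ⨆ (m : ℕ) (_ : m ≤ 3), ENNReal.ofReal (1 + √(√((⨅ i, ‖E4.spatial x.1 - ξ i t‖) ^ 7))) * ‖iteratedFDeriv ℝ m (𝒟.toSpacetime.deviationExtend B Φ) x.1‖ₑ) atTop (𝓝 0) ∧ O = Summit.FinalStateConjecture.exteriorOf 𝒟.toCauchyDevelopment (Φ '' {x : U | τ₀ < x.1 0 ∧ ∀ i, Kerr.rPlus (M i) (a i) < Kerr.radius (a i) (poincareInv (Λ i (x.1 0)) (E4.ofTimeSpace (x.1 0) (ξ i (x.1 0))) x.1)}) ∧ ∀ t₁ : ℝ, τ₀ < t₁ → O \ Φ '' {x : U | t₁ < x.1 0 ∧ ∀ i, Kerr.rPlus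 (M i) (a i) < Kerr.radius (a i) (poincareInv (Λ i (x.1 0)) (E4.ofTimeSpace (x.1 0) (ξ i (x.1 0))) x.1)} ⊆ 𝒟.metric.causalPast 𝒟.timeOrientation (Φ '' {x : U | x.1 0 = t₁ ∧ ∀ i, Kerr.rPlus (M i) (a i) < Kerr.radius (a i) (poincareInv (Λ i (x.1 0)) (E4.ofTimeSpace (x.1 0) (ξ i (x.1 0))) x.1)})) →
    (∀ i : Fin N, (∀ m : ℕ, 1 ≤ m → m ≤ 3 → Tendsto (fun t ↦ iteratedDeriv m (fun s ↦ (((Λ i s : lorentzGroup) : E4 ≃L[ℝ] E4) (E4.basisVector 0))) t) atTop (𝓝 0)) ∧ (∀ m : ℕ, m ≤ 2 → Tendsto (fun t ↦ iteratedDeriv m (fun s ↦ deriv (ξ i) s - (((((Λ i s : lorentzGroup) : E4 ≃L[ℝ] E4) (E4.basisVector 0)) 0)⁻¹ • E4.spatial (((Λ i s : lorentzGroup) : E4 ≃L[ℝ] E4) (E4.basisVector 0)))) t) atTop (𝓝 0)) ∧ (a i ≠ 0 → ∀ m : ℕ, 1 ≤ m → m ≤ 3 → Tendsto (fun t ↦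 iteratedDeriv m (fun s ↦ (((Λ i s : lorentzGroup) : E4 ≃L[ℝ] E4) (E4.basisVector 3))) t) atTop (𝓝 0))) ∧
    ((∀ i : Fin N, Continuous (fun t ↦ (((((Λ i t : lorentzGroup) : E4 ≃L[ℝ] E4) (E4.basisVector 0)) 0)⁻¹ • E4.spatial (((Λ i t : lorentzGroup) : E4 ≃L[ℝ] E4) (E4.basisVector 0))))) ∧ (∃ k : ℝ, 0 ≤ k ∧ k < 1 ∧ ∀ (i : Fin N) (t : ℝ), ‖(((((Λ i t : lorentzGroup) : E4 ≃L[ℝ] E4) (E4.basisVector 0)) 0)⁻¹ • E4.spatial (((Λ i t : lorentzGroup) : E4 ≃L[ℝ] E4) (E4.basisVector 0)))‖ ≤ k)) := by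
  sorry

/-- **K3′ · QUASI-STATIONARITY OF THE MODULATED BACKGROUND (painting rigidity, hierarchical).** Under the antecedent and
third-order slaving, for every radius function `ρ(t) → ∞`: `(1 + d^{7/4})‖∂_{x⁰}G(λ(·))(x)‖ → 0` uniformly on
`{x⁰ = t, |x̲| ≤ κt, d(x) ≥ ρ(t)}`, where `G(λ(t))` is the crux's background field and `∂_{x⁰}` its TOTAL lab-time derivative
(frozen part `O(M/d²)`, fine against the weight once `d ≥ ρ(t) → ∞`; painted-rate part `Σⱼ(u̇ⱼ·∂_uKⱼ + μⱼ·∂_cKⱼ)`, bounded by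
the backward reading of the vacuum shell identity on hole-free static shells — group rates `|Σ_{j∈G}Mⱼu̇ⱼ| = o(r^{-3/4})` at
every isolation scale `r`, individual `o(sⱼ^{-3/4})`, dipole-suppressed to `o(d^{-7/4})`). Equivalently (since
`∂ₜ(Φ^*g − G) = o(d^{-7/4})` is the `m = 1` clause): the TRUE lab metric is quasi-stationary at the weighted rate off the
tubes. Size L/XL. Why it might fail: hierarchical squeeze inside nested groups needs a-priori smallness of the rates (from
slaving) and straggler bookkeeping. [LL §96; card scale-t-static-sphere-charges; Negative/PaintingRigidityStabiliser] -/
theorem stub_quasiStationarity : ∀ (X : Type) [TopologicalSpace X] [ChartedSpace E3 X] [IsManifold (𝓡 3) ((⊤ : ℕ∞) : WithTop ℕ∞) X] [T2Space X] [SecondCountableTopology X] [ConnectedSpace X], ∀ D ∈ admissibleVacuumData X, ∀ 𝒟 : VacuumCauchyDevelopment D, 𝒟.IsMaximal → ∀ (N : ℕ) (M a rin : Fin N → ℝ) (Λ : Fin N → ℝ → lorentzGroup) (ξ : Fin N → ℝ → E3) (γ κ τ₀ : ℝ) (U : Opens E4) (Φ : U → 𝒟.carrier) (O : Set 𝒟.carrier),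 ((∀ i, Kerr.IsSubextremal (M i) (a i) ∧ Kerr.rMinus (M i) (a i) < rin i ∧ rin i < Kerr.rPlus (M i) (a i)) ∧ (∀ i t, |((Λ i t : E4 ≃L[ℝ] E4) (E4.basisVector 0)) 0| ≤ γ) ∧ (∀ i, ContDiff ℝ ((⊤ : ℕ∞) : WithTop ℕ∞) (ξ i) ∧ ContDiff ℝ ((⊤ : ℕ∞) : WithTop ℕ∞) (fun t ↦ ((Λ i t : E4 ≃L[ℝ] E4) : E4 →L[ℝ] E4))) ∧ (∀ i j, i ≠ j → Tendsto (fun t ↦ ‖ξ i t - ξ j t‖) atTop atTop) ∧ (0 < κ ∧ κ < 1 ∧ ∀ i, ∀ᶠ t in atTop, ‖ξ i t‖ ≤ κ ^ 2 * t) ∧ ({x : E4 | τ₀ < x 0 ∧ ∀ i, rin i < Kerr.radius (a i) (poincareInv (Λ i (x 0)) (E4.ofTimeSpace (x 0) (ξ i (x 0))) x)} ⊆ (U : Set E4)) ∧ let B : ModelBackground := ⟨U, fun x ↦ Minkowski.bilin + ∑ i, (boostedKerrBilin (Λ i (x 0)) (E4.ofTimeSpace (x 0) (ξ i (x 0)))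 (M i) (a i) x - Minkowski.bilin), fun x ↦ x 0, E4.spatialNorm⟩; ContMDiff 𝓘(ℝ, E4) (𝓡 4) ((⊤ : ℕ∞) : WithTop ℕ∞) Φ ∧ Topology.IsOpenEmbedding ((B.lateRegion τ₀).restrict Φ) ∧ Φ '' {x : U | τ₀ < x.1 0 ∧ ∀ i, Kerr.rPlus (M i) (a i) < Kerr.radius (a i) (poincareInv (Λ i (x.1 0)) (E4.ofTimeSpace (x.1 0) (ξ i (x.1 0))) x.1)} ⊆ O ∧ Tendsto (fun t ↦ 𝒟.toSpacetime.deviationCk B Φ 3 t) atTop (𝓝 0) ∧ Tendsto (fun t : ℝ ↦ ⨆ x ∈ {x : U | x.1 0 = t ∧ E4.spatialNorm x.1 ≤ κ * t}, ⨆ (m : ℕ) (_ : m ≤ 3), ENNReal.ofReal (1 + √(√((⨅ i, ‖E4.spatial x.1 - ξ i t‖) ^ 7))) * ‖iteratedFDeriv ℝ m (𝒟.toSpacetime.deviationExtend B Φ) x.1‖ₑ) atTop (𝓝 0) ∧ O = Summit.FinalStateConjecture.exteriorOf 𝒟.toCauchyDevelopment (Φ '' {x : U | τ₀ < x.1 0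 ∧ ∀ i, Kerr.rPlus (M i) (a i) < Kerr.radius (a i) (poincareInv (Λ i (x.1 0)) (E4.ofTimeSpace (x.1 0) (ξ i (x.1 0))) x.1)}) ∧ ∀ t₁ : ℝ, τ₀ < t₁ → O \ Φ '' {x : U | t₁ < x.1 0 ∧ ∀ i, Kerr.rPlus (M i) (a i) < Kerr.radius (a i) (poincareInv (Λ i (x.1 0)) (E4.ofTimeSpace (x.1 0) (ξ i (x.1 0))) x.1)} ⊆ 𝒟.metric.causalPast 𝒟.timeOrientation (Φ '' {x : U | x.1 0 = t₁ ∧ ∀ i, Kerr.rPlus (M i) (a i) < Kerr.radius (a i) (poincareInv (Λ i (x.1 0)) (E4.ofTimeSpace (x.1 0) (ξ i (x.1 0))) x.1)})) →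
    (∀ i : Fin N, (∀ m : ℕ, 1 ≤ m → m ≤ 3 → Tendsto (fun t ↦ iteratedDeriv m (fun s ↦ (((Λ i s : lorentzGroup) : E4 ≃L[ℝ] E4) (E4.basisVector 0))) t) atTop (𝓝 0)) ∧ (∀ m : ℕ, m ≤ 2 → Tendsto (fun t ↦ iteratedDeriv m (fun s ↦ deriv (ξ i) s - (((((Λ i s : lorentzGroup) : E4 ≃L[ℝ] E4) (E4.basisVector 0)) 0)⁻¹ • E4.spatial (((Λ i s : lorentzGroup) : E4 ≃L[ℝ] E4) (E4.basisVector 0)))) t) atTop (𝓝 0)) ∧ (a i ≠ 0 → ∀ m : ℕ, 1 ≤ m → m ≤ 3 → Tendsto (fun t ↦ iteratedDeriv m (fun s ↦ (((Λ i s : lorentzGroup) : E4 ≃L[ℝ] E4) (E4.basisVector 3))) t) atTop (𝓝 0))) →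
    (∀ ρ : ℝ → ℝ, Tendsto ρ atTop atTop → Tendsto (fun t : ℝ ↦ ⨆ x ∈ {x : E4 | x 0 = t ∧ E4.spatialNorm x ≤ κ * t ∧ ρ t ≤ ⨅ i, ‖E4.spatial x - ξ i t‖}, ENNReal.ofReal (1 + √(√((⨅ i, ‖E4.spatial x - ξ i t‖) ^ 7))) * ‖fderiv ℝ (fun y : E4 ↦ Minkowski.bilin + ∑ i, (boostedKerrBilin (Λ i (y 0)) (E4.ofTimeSpace (y 0) (ξ i (y 0))) (M i) (a i) y - Minkowski.bilin)) x (E4.basisVector 0)‖ₑ) atTop (𝓝 0)) := by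
  sorry

/-- **LL · THE DENSITISED LANDAU–LIFSHITZ PSEUDOTENSOR IS QUADRATIC IN FIRST DERIVATIVES (bound form of LL (96.8)/(96.9)).**
For metric components `g` of class `C²` at `x`, symmetric near `x`, with `‖g(x) − η‖ ≤ 1/2` (so that `(g_{μν})` is
invertible with inverse and determinant bounded by universal constants): `|(−g)(x) t^{μν}_LL(x)| ≤ C‖Dg(x)‖²` with ONE
universal `C`. Here `pseudotensor` is the tree's DEFINITION `t^{μν} = (−g)⁻¹Σ_α∂_α h^{μνα} − (8π)⁻¹G^{μν}`
(`LandauLifshitzPseudotensor.lean`); the content is Landau–Lifshitz's theorem that the second derivatives cancel in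
`(16π)⁻¹∂_α∂_β H^{μανβ} − (−g)G^{μν}/(8π)`, leaving the explicit quadratic form (96.9) in `∂𝔤` with coefficients
polynomial in `𝔤`, `(−g)^{±1/2}`. Proof route: only the PRINCIPAL PARTS (terms carrying `∂²g`) of both sides need to be
matched — every other term of `∂∂H` is structurally `(∂g)(∂g)·poly(g⁻¹, det g)`. Size XL (symbolic), S to state.
[cite: LandauLifshitz1975, §96 (96.8)–(96.9)] [arXiv:1310.1528 §2] -/
theorem stub_pseudotensorBound :
    (∃ C : ℝ, 0 ≤ C ∧ ∀ (g : E4 → E4 →L[ℝ] E4 →L[ℝ] ℝ) (x : E4) (b : ℝ), ContDiffAt ℝ 2 g x → (∀ᶠ y in 𝓝 x, ∀ v w : E4, g y v w = g y w v) → ‖g x - Minkowski.bilin‖ ≤ 1 / 2 → (∀ v : E4, ‖fderiv ℝ g x v‖ ≤ b * ‖v‖) → ∀ μ ν : Fin 4, |LandauLifshitz.metricDet g x * LandauLifshitz.pseudotensor g x μ ν| ≤ C * b ^ 2) := by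
  sorry

/-- **K3 · WINDOW CHARGES, quantitative (Landau–Lifshitz calculus on an abstract vacuum metric field; no black holes, no
painting).** Granted the pseudotensor bound: for smooth symmetric Ricci-flat components `g` on an open `W ⊆ E4` and `C¹`
moving coordinate spheres `S_t = {x⁰ = t, |y − c(t)| = R(t)} ⊆ W` (`t ≥ T > 0`, speeds `‖ċ‖, |Ṙ| ≤ 2`, `R ≥ 1`) on which
`‖g − η‖ ≤ 1/2` and `‖Dg‖ ≤ b(t)` (`b` continuous), the quasi-local momenta obey
`|P^μ(t₂) − P^μ(t₁)| ≤ C∫_{t₁}^{t₂} R²b²` with a universal `C`. Mechanism: transport theorem for the flux of `h^{μ0j}` through a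
closed moving surface, `∂_j h^{μ0j} = (−g)(T+t)^{μ0}`, `∂ₜh^{μ0j} = −(−g)(T+t)^{μj} + (curl)` (antisymmetry of `H`), so in
vacuum `dP^μ/dt = −∮((−g)t^{μj} − (−g)t^{μ0}v_S^j)n_j dσ`, and `|(−g)t| ≤ Cb²` by the bound, area `4πR²`, `|v_S| ≤ 4`.
Size L (transport + Stokes on coordinate spheres with `μHE[2]` are not in Mathlib). [LL §96 (96.10)–(96.16); arXiv:1310.1528 §2;
route support `LLBalanceLaw` (stmt-FinalStateConjecture-10189) (iii) is the static-sphere case] -/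
theorem stub_windowCharges :
    (∃ C : ℝ, 0 ≤ C ∧ ∀ (g : E4 → E4 →L[ℝ] E4 →L[ℝ] ℝ) (x : E4) (b : ℝ), ContDiffAt ℝ 2 g x → (∀ᶠ y in 𝓝 x, ∀ v w : E4, g y v w = g y w v) → ‖g x - Minkowski.bilin‖ ≤ 1 / 2 → (∀ v : E4, ‖fderiv ℝ g x v‖ ≤ b * ‖v‖) → ∀ μ ν : Fin 4, |LandauLifshitz.metricDet g x * LandauLifshitz.pseudotensor g x μ ν| ≤ C * b ^ 2) →
    (∃ C : ℝ, ∀ (g : E4 → E4 →L[ℝ] E4 →L[ℝ] ℝ) (W : Set E4) (c : ℝ → E3) (R b : ℝ → ℝ) (T : ℝ), IsOpen W → ContDiffOn ℝ (⊤ : ℕ∞) g W → (∀ x ∈ W, ∀ v w : E4, g x v w = g x w v) → (∀ x ∈ W, MetricCoord.ricAt g x = 0) → 0 < T → ContDiff ℝ 1 c → ContDiff ℝ 1 R → ContinuousOn b (Set.Ici T) → (∀ t, T ≤ t → ‖deriv c t‖ ≤ 2 ∧ |deriv R t| ≤ 2 ∧ 1 ≤ R t) → (∀ t, T ≤ t →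 ∀ y ∈ Metric.sphere (c t) (R t), E4.ofTimeSpace t y ∈ W ∧ ‖g (E4.ofTimeSpace t y) - Minkowski.bilin‖ ≤ 1 / 2 ∧ ∀ v : E4, ‖fderiv ℝ g (E4.ofTimeSpace t y) v‖ ≤ b t * ‖v‖) → ∀ t₁ t₂ : ℝ, T ≤ t₁ → t₁ ≤ t₂ → ∀ μ : Fin 4, |LandauLifshitz.quasiLocalMomentum g t₂ (c t₂) (R t₂) μ - LandauLifshitz.quasiLocalMomentum g t₁ (c t₁) (R t₁) μ| ≤ C * ∫ s in t₁..t₂, R s ^ 2 * b s ^ 2) := by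
  sorry

/-- **K2a · CHARGE MODEL OF THE LAB METRIC (window law + identification; the GR half of the planner's `stub_cleanWindow` /
`stub_cesaroOfCleanWindow`).** Granted window charges, under the antecedent, third-order slaving and quasi-stationarity, the
Landau–Lifshitz charges `P(t,c,R) := quasiLocalMomentum (labMetric) t c R` of the TRUE lab metric
`labMetric = G(λ(x⁰)) + deviationExtend = Φ^*g` (on `U`) satisfy, above EVERY threshold `ρ(t) → ∞` and for every clearance
`δ ∈ (0,1)`: (WINDOW LAW) along 2-Lipschitz paths of δ-admissible windows (`ρ ≤ δR`; `‖c‖ + R ≤ (κ+κ²)t/2`, i.e. inside the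
middle cone; every centre within `(1−δ)R` or beyond `(1+δ)R`) the charge changes by at most `C∫R^{-3/2}`: flux quadratic in
`∂(labMetric)` (window charges with `Ric(Φ^*g) = 0` from `𝒟` vacuum, pulled back to coordinates), and on a δ-clear sphere
`∂g = O(M/(δR)²) + o((δR)^{-7/4})` (explicit Kerr–Schild fields + the weighted `m = 1` clause + quasi-stationarity for `∂ₜ`),
so `R²b² ≤ C_δ(M²R⁻² + ε²R^{-3/2}) ≤ C R^{-3/2}`; Lipschitz paths by smoothing/transport. (IDENTIFICATION) the charge of a
window equals the sum over the members (centres within `(1−δ)R`) of `Mⱼγ(vⱼ)(1, vⱼ)`, `vⱼ = v(Λⱼ(t))`, up to `ζ(t) → 0`: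
exact Kerr–Schild charge `γM(1,v)` of each boosted hole at a slowly growing inner radius `ρ₀(t)` (toy j005997: `P⁰ = γM`),
then the VACUUM SHELL IDENTITY `P(R) − P(ρ₀) = ∫_shell(−g)t^{μ0}` (quadratic: `M²/ρ₀ + εMρ₀^{-3/4} + ε²ρ₀^{-1/2} → 0`) — so the
linear surface term `ε R^{1/4}` is only ever read at `ρ₀` with `ερ₀^{1/4} → 0` — and perforated Gauss for additivity
(members pairwise `≥` a slowly growing distance apart since all `Dᵢⱼ → ∞`). Size XL. Why it might fail: the Ricci bridge
(`𝒟.isRicciFlat` ⇒ `MetricCoord.ricAt (labMetric) = 0` on `U`) and `hField` of boosted Kerr–Schild at finite `R` for `a ≠ 0`.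
[LL §96 (96.16)–(96.17); doi:10.1086/150170; card scale-t-static-sphere-charges] -/
theorem stub_chargeModel :
    (∃ C : ℝ, ∀ (g : E4 → E4 →L[ℝ] E4 →L[ℝ] ℝ) (W : Set E4) (c : ℝ → E3) (R b : ℝ → ℝ) (T : ℝ), IsOpen W → ContDiffOn ℝ (⊤ : ℕ∞) g W → (∀ x ∈ W, ∀ v w : E4, g x v w = g x w v) → (∀ x ∈ W, MetricCoord.ricAt g x = 0) → 0 < T → ContDiff ℝ 1 c → ContDiff ℝ 1 R → ContinuousOn b (Set.Ici T) → (∀ t, T ≤ t → ‖deriv c t‖ ≤ 2 ∧ |deriv R t| ≤ 2 ∧ 1 ≤ R t) → (∀ t, T ≤ t → ∀ y ∈ Metric.sphere (c t) (R t), E4.ofTimeSpace t y ∈ W ∧ ‖g (E4.ofTimeSpace t y) - Minkowski.bilin‖ ≤ 1 / 2 ∧ ∀ v : E4, ‖fderiv ℝ g (E4.ofTimeSpace t y) v‖ ≤ b t * ‖v‖) → ∀ t₁ t₂ : ℝ, T ≤ t₁ → t₁ ≤ t₂ → ∀ μ : Fin 4, |LandauLifshitz.quasiLocalMomentum g t₂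 (c t₂) (R t₂) μ - LandauLifshitz.quasiLocalMomentum g t₁ (c t₁) (R t₁) μ| ≤ C * ∫ s in t₁..t₂, R s ^ 2 * b s ^ 2) →
    ∀ (X : Type) [TopologicalSpace X] [ChartedSpace E3 X] [IsManifold (𝓡 3) ((⊤ : ℕ∞) : WithTop ℕ∞) X] [T2Space X] [SecondCountableTopology X] [ConnectedSpace X], ∀ D ∈ admissibleVacuumData X, ∀ 𝒟 : VacuumCauchyDevelopment D, 𝒟.IsMaximal → ∀ (N : ℕ) (M a rin : Fin N → ℝ) (Λ : Fin N → ℝ → lorentzGroup) (ξ : Fin N → ℝ → E3) (γ κ τ₀ : ℝ) (U : Opens E4) (Φ : U → 𝒟.carrier) (O : Set 𝒟.carrier), ((∀ i, Kerr.IsSubextremal (M i) (a i) ∧ Kerr.rMinus (M i) (a i) < rin i ∧ rin i < Kerr.rPlus (M i) (a i)) ∧ (∀ i t, |((Λ i t : E4 ≃L[ℝ] E4) (E4.basisVector 0)) 0| ≤ γ) ∧ (∀ i, ContDiff ℝ ((⊤ : ℕ∞) : WithTop ℕ∞) (ξ i) ∧ ContDiff ℝ ((⊤ : ℕ∞) :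 WithTop ℕ∞) (fun t ↦ ((Λ i t : E4 ≃L[ℝ] E4) : E4 →L[ℝ] E4))) ∧ (∀ i j, i ≠ j → Tendsto (fun t ↦ ‖ξ i t - ξ j t‖) atTop atTop) ∧ (0 < κ ∧ κ < 1 ∧ ∀ i, ∀ᶠ t in atTop, ‖ξ i t‖ ≤ κ ^ 2 * t) ∧ ({x : E4 | τ₀ < x 0 ∧ ∀ i, rin i < Kerr.radius (a i) (poincareInv (Λ i (x 0)) (E4.ofTimeSpace (x 0) (ξ i (x 0))) x)} ⊆ (U : Set E4)) ∧ let B : ModelBackground := ⟨U, fun x ↦ Minkowski.bilin + ∑ i, (boostedKerrBilin (Λ i (x 0)) (E4.ofTimeSpace (x 0) (ξ i (x 0))) (M i) (a i) x - Minkowski.bilin), fun x ↦ x 0, E4.spatialNorm⟩; ContMDiff 𝓘(ℝ, E4) (𝓡 4) ((⊤ : ℕ∞) : WithTop ℕ∞) Φ ∧ Topology.IsOpenEmbedding ((B.lateRegion τ₀).restrict Φ) ∧ Φ '' {x : U | τ₀ < x.1 0 ∧ ∀ i, Kerr.rPlus (M i) (a i) < Kerr.radius (a i) (poincareInv (Λ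 i (x.1 0)) (E4.ofTimeSpace (x.1 0) (ξ i (x.1 0))) x.1)} ⊆ O ∧ Tendsto (fun t ↦ 𝒟.toSpacetime.deviationCk B Φ 3 t) atTop (𝓝 0) ∧ Tendsto (fun t : ℝ ↦ ⨆ x ∈ {x : U | x.1 0 = t ∧ E4.spatialNorm x.1 ≤ κ * t}, ⨆ (m : ℕ) (_ : m ≤ 3), ENNReal.ofReal (1 + √(√((⨅ i, ‖E4.spatial x.1 - ξ i t‖) ^ 7))) * ‖iteratedFDeriv ℝ m (𝒟.toSpacetime.deviationExtend B Φ) x.1‖ₑ) atTop (𝓝 0) ∧ O = Summit.FinalStateConjecture.exteriorOf 𝒟.toCauchyDevelopment (Φ '' {x : U | τ₀ < x.1 0 ∧ ∀ i, Kerr.rPlus (M i) (a i) < Kerr.radius (a i) (poincareInv (Λ i (x.1 0)) (E4.ofTimeSpace (x.1 0) (ξ i (x.1 0))) x.1)}) ∧ ∀ t₁ : ℝ, τ₀ < t₁ → O \ Φ '' {x : U | t₁ < x.1 0 ∧ ∀ i, Kerr.rPlus (M i) (a i) < Kerr.radius (a i) (poincareInv (Λ i (x.1 0)) (E4.ofTimeSpace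 (x.1 0) (ξ i (x.1 0))) x.1)} ⊆ 𝒟.metric.causalPast 𝒟.timeOrientation (Φ '' {x : U | x.1 0 = t₁ ∧ ∀ i, Kerr.rPlus (M i) (a i) < Kerr.radius (a i) (poincareInv (Λ i (x.1 0)) (E4.ofTimeSpace (x.1 0) (ξ i (x.1 0))) x.1)})) →
    (∀ i : Fin N, (∀ m : ℕ, 1 ≤ m → m ≤ 3 → Tendsto (fun t ↦ iteratedDeriv m (fun s ↦ (((Λ i s : lorentzGroup) : E4 ≃L[ℝ] E4) (E4.basisVector 0))) t) atTop (𝓝 0)) ∧ (∀ m : ℕ, m ≤ 2 → Tendsto (fun t ↦ iteratedDeriv m (fun s ↦ deriv (ξ i) s - (((((Λ i s : lorentzGroup) : E4 ≃L[ℝ] E4) (E4.basisVector 0)) 0)⁻¹ • E4.spatial (((Λ i s : lorentzGroup) : E4 ≃L[ℝ] E4) (E4.basisVector 0)))) t) atTop (𝓝 0)) ∧ (a i ≠ 0 → ∀ m : ℕ, 1 ≤ m → m ≤ 3 → Tendsto (fun t ↦ iteratedDeriv m (fun s ↦ (((Λ i s : lorentzGroup) : E4 ≃L[ℝ] E4)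 (E4.basisVector 3))) t) atTop (𝓝 0))) →
    (∀ ρ : ℝ → ℝ, Tendsto ρ atTop atTop → Tendsto (fun t : ℝ ↦ ⨆ x ∈ {x : E4 | x 0 = t ∧ E4.spatialNorm x ≤ κ * t ∧ ρ t ≤ ⨅ i, ‖E4.spatial x - ξ i t‖}, ENNReal.ofReal (1 + √(√((⨅ i, ‖E4.spatial x - ξ i t‖) ^ 7))) * ‖fderiv ℝ (fun y : E4 ↦ Minkowski.bilin + ∑ i, (boostedKerrBilin (Λ i (y 0)) (E4.ofTimeSpace (y 0) (ξ i (y 0))) (M i) (a i) y - Minkowski.bilin)) x (E4.basisVector 0)‖ₑ) atTop (𝓝 0)) →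
    (∀ ρ : ℝ → ℝ, Tendsto ρ atTop atTop → ∀ δ : ℝ, 0 < δ → δ < 1 → ∃ (C T : ℝ), ∀ (t₁ t₂ : ℝ) (c : ℝ → E3) (R : ℝ → ℝ), T ≤ t₁ → t₁ ≤ t₂ → (∀ s ∈ Set.Icc t₁ t₂, ∀ s' ∈ Set.Icc t₁ t₂, ‖c s - c s'‖ ≤ 2 * |s - s'| ∧ |R s - R s'| ≤ 2 * |s - s'|) → (∀ s ∈ Set.Icc t₁ t₂, ρ s ≤ δ * R s ∧ ‖c s‖ + R s ≤ (κ + κ ^ 2) / 2 * s ∧ ∀ j, ‖ξ j s - c s‖ ≤ (1 - δ) * R s ∨ (1 + δ) * R s ≤ ‖ξ j s - c s‖) → ∀ μ : Fin 4, |(LandauLifshitz.quasiLocalMomentum (fun x : E4 ↦ (Minkowski.bilin + ∑ i, (boostedKerrBilin (Λ i (x 0)) (E4.ofTimeSpace (x 0) (ξ i (x 0))) (M i) (a i) x - Minkowski.bilin)) + 𝒟.toSpacetime.deviationExtend (⟨U, fun x ↦ Minkowski.bilin + ∑ i, (boostedKerrBilin (Λ i (x 0)) (E4.ofTimeSpace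 (x 0) (ξ i (x 0))) (M i) (a i) x - Minkowski.bilin), fun x ↦ x 0, E4.spatialNorm⟩ : ModelBackground) Φ x)) t₂ (c t₂) (R t₂) μ - (LandauLifshitz.quasiLocalMomentum (fun x : E4 ↦ (Minkowski.bilin + ∑ i, (boostedKerrBilin (Λ i (x 0)) (E4.ofTimeSpace (x 0) (ξ i (x 0))) (M i) (a i) x - Minkowski.bilin)) + 𝒟.toSpacetime.deviationExtend (⟨U, fun x ↦ Minkowski.bilin + ∑ i, (boostedKerrBilin (Λ i (x 0)) (E4.ofTimeSpace (x 0) (ξ i (x 0))) (M i) (a i) x - Minkowski.bilin), fun x ↦ x 0, E4.spatialNorm⟩ : ModelBackground) Φ x)) t₁ (c t₁) (R t₁) μ| ≤ C * ∫ s in t₁..t₂, (R s ^ (3 / 2 : ℝ))⁻¹) ∧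
    (∀ ρ : ℝ → ℝ, Tendsto ρ atTop atTop → ∀ δ : ℝ, 0 < δ → δ < 1 → ∃ (T : ℝ) (ζ : ℝ → ℝ), Tendsto ζ atTop (𝓝 0) ∧ ∀ (t : ℝ) (c : E3) (R : ℝ) (A : Finset (Fin N)), T ≤ t → ρ t ≤ δ * R → ‖c‖ + R ≤ (κ + κ ^ 2) / 2 * t → (∀ j, ‖ξ j t - c‖ ≤ (1 - δ) * R ∨ (1 + δ) * R ≤ ‖ξ j t - c‖) → (∀ j, j ∈ A ↔ ‖ξ j t - c‖ ≤ (1 - δ) * R) → |(LandauLifshitz.quasiLocalMomentum (fun x : E4 ↦ (Minkowski.bilin + ∑ i, (boostedKerrBilin (Λ i (x 0)) (E4.ofTimeSpace (x 0) (ξ i (x 0))) (M i) (a i) x - Minkowski.bilin)) + 𝒟.toSpacetime.deviationExtend (⟨U, fun x ↦ Minkowski.bilin + ∑ i, (boostedKerrBilin (Λ i (x 0)) (E4.ofTimeSpace (x 0) (ξ i (x 0))) (M i) (a i) x - Minkowski.bilin), fun x ↦ x 0, E4.spatialNorm⟩ : ModelBackground) Φ x)) t c R 0 - ∑ j ∈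 A, M j * (√(1 - ‖(((((Λ j t : lorentzGroup) : E4 ≃L[ℝ] E4) (E4.basisVector 0)) 0)⁻¹ • E4.spatial (((Λ j t : lorentzGroup) : E4 ≃L[ℝ] E4) (E4.basisVector 0)))‖ ^ 2))⁻¹| ≤ ζ t ∧ ∀ k : Fin 3, |(LandauLifshitz.quasiLocalMomentum (fun x : E4 ↦ (Minkowski.bilin + ∑ i, (boostedKerrBilin (Λ i (x 0)) (E4.ofTimeSpace (x 0) (ξ i (x 0))) (M i) (a i) x - Minkowski.bilin)) + 𝒟.toSpacetime.deviationExtend (⟨U, fun x ↦ Minkowski.bilin + ∑ i, (boostedKerrBilin (Λ i (x 0)) (E4.ofTimeSpace (x 0) (ξ i (x 0))) (M i) (a i) x - Minkowski.bilin), fun x ↦ x 0, E4.spatialNorm⟩ : ModelBackground) Φ x)) t c R k.succ - ∑ j ∈ A, M j * (√(1 - ‖(((((Λ j t : lorentzGroup) : E4 ≃L[ℝ] E4) (E4.basisVector 0)) 0)⁻¹ • E4.spatial (((Λ j t : lorentzGroup) : E4 ≃L[ℝ] E4) (E4.basisVector 0)))‖ ^ 2))⁻¹ * (((((Λ j t :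 lorentzGroup) : E4 ≃L[ℝ] E4) (E4.basisVector 0)) 0)⁻¹ • E4.spatial (((Λ j t : lorentzGroup) : E4 ≃L[ℝ] E4) (E4.basisVector 0))) k| ≤ ζ t) := by
  sorry

/-- **K2b · THE ENDGAME: abstract window charges ⇒ Cesàro velocities (Mathlib-only real analysis; lead's stub).** An
"expanding system of charges": `N` smooth centres in the cone `‖ξᵢ‖ ≤ κ²t`, pairwise separating, slaved (`ξ̇ᵢ − vᵢ → 0`)
to continuous velocities with `‖vᵢ‖ ≤ k < 1`, and abstract charges `P` obeying the WINDOW LAW (`|ΔP| ≤ C∫R^{-3/2}` on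
2-Lipschitz δ-admissible window paths above any `ρ → ∞`) and IDENTIFICATION (`P(window) = Σ_members Mⱼγⱼ(1,vⱼ) + o(1)`)
— then every `ξᵢ(t)/t` converges. Proof plan: choose `ρ(t) := min(√t, (min_{i≠j}‖ξᵢ−ξⱼ‖)^{1/2})`, per-hole windows
`R = min(dᵢ/4, (κ−κ²)t/4)` (always admissible, `|ΔP| ≲ ∫dᵢ^{-3/2}`), the global/cluster windows at scale `≍ t` (charges
CONVERGE: `∫t^{-3/2} < ∞`; the global window needs `δ < (1−κ)/(1+κ)`). `N = 1`: `Mγ(v)(1,v)` converges ⇒ `v` converges ⇒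
`ξ/t` converges. Pairs: either `liminf d/t > 0` (per-hole charges converge ⇒ velocities converge) or the relative velocity
tends to `0` (BOOTSTRAP: relative speed `w₀` at distance `d` forces separation `λd` within time `λd/w₀` at impulse cost
`≲ d^{-1/2}/w₀ + t^{-1/2} → 0`, then linear recession forever — contradiction), whence `d = o(t)`, the pair is one cluster,
its charge converges and `v₁, v₂ → P_∞/E_∞`. General `N`: induction over clusters (velocity equalisation inside, charge
convergence at scale `t` outside). The kinematic witness of `Negative/KinematicShadow` violates the window law on its own
isolated window, so nothing is derived from kinematics. Size L. -/
theorem stub_cesaroEndgame :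
    ∀ (N : ℕ) (M : Fin N → ℝ) (ξ v : Fin N → ℝ → E3) (κ : ℝ) (P : ℝ → E3 → ℝ → Fin 4 → ℝ), (∀ i, 0 < M i) → 0 < κ → κ < 1 → (∀ i, ContDiff ℝ ((⊤ : ℕ∞) : WithTop ℕ∞) (ξ i)) → (∀ i, ∀ᶠ t in atTop, ‖ξ i t‖ ≤ κ ^ 2 * t) → (∀ i j, i ≠ j → Tendsto (fun t ↦ ‖ξ i t - ξ j t‖) atTop atTop) → (∀ i, Continuous (v i)) → (∃ k : ℝ, 0 ≤ k ∧ k < 1 ∧ ∀ i t, ‖v i t‖ ≤ k) → (∀ i, Tendsto (fun t ↦ deriv (ξ i) t - v i t) atTop (𝓝 0)) → (∀ ρ : ℝ → ℝ, Tendsto ρ atTop atTop → ∀ δ : ℝ, 0 < δ → δ < 1 → ∃ (C T : ℝ), ∀ (t₁ t₂ : ℝ) (c : ℝ → E3) (R : ℝ → ℝ), T ≤ t₁ → t₁ ≤ t₂ → (∀ s ∈ Set.Icc t₁ t₂, ∀ s' ∈ Set.Icc t₁ t₂, ‖c s - c s'‖ ≤ 2 * |s - s'| ∧ |R s - R s'|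 ≤ 2 * |s - s'|) → (∀ s ∈ Set.Icc t₁ t₂, ρ s ≤ δ * R s ∧ ‖c s‖ + R s ≤ (κ + κ ^ 2) / 2 * s ∧ ∀ j, ‖ξ j s - c s‖ ≤ (1 - δ) * R s ∨ (1 + δ) * R s ≤ ‖ξ j s - c s‖) → ∀ μ : Fin 4, |P t₂ (c t₂) (R t₂) μ - P t₁ (c t₁) (R t₁) μ| ≤ C * ∫ s in t₁..t₂, (R s ^ (3 / 2 : ℝ))⁻¹) → (∀ ρ : ℝ → ℝ, Tendsto ρ atTop atTop → ∀ δ : ℝ, 0 < δ → δ < 1 → ∃ (T : ℝ) (ζ : ℝ → ℝ), Tendsto ζ atTop (𝓝 0) ∧ ∀ (t : ℝ) (c : E3) (R : ℝ) (A : Finset (Fin N)), T ≤ t → ρ t ≤ δ * R → ‖c‖ + R ≤ (κ + κ ^ 2) / 2 * t → (∀ j, ‖ξ j t - c‖ ≤ (1 - δ) * R ∨ (1 + δ) * R ≤ ‖ξ j t - c‖) → (∀ j, j ∈ A ↔ ‖ξ j t - c‖ ≤ (1 - δ) * R) → |P t c R 0 - ∑ j ∈ A, M j * (√(1 - ‖v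 j t‖ ^ 2))⁻¹| ≤ ζ t ∧ ∀ k : Fin 3, |P t c R k.succ - ∑ j ∈ A, M j * (√(1 - ‖v j t‖ ^ 2))⁻¹ * v j t k| ≤ ζ t) → ∀ i, ∃ V : E3, Tendsto (fun t : ℝ ↦ t⁻¹ • ξ i t) atTop (𝓝 V) := by
  sorry

/-- **P2 · RE-CHARTING (the transfer, realised).** Under the antecedent, third-order slaving and Cesàro velocities the crux's
conclusion holds. Labels `Λᵢ^f := boost(Vᵢ)` (`‖Vᵢ‖ ≤ κ² < 1`), `cᵢ := 0`; stabiliser-free frames `Λ̃ᵢ(t)` built from `uᵢ(t)`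
(and the painted axis if `aᵢ ≠ 0`), all of whose derivatives up to order 3 tend to `0` by slaving; hole charts
`Ψᵢ := Φ ∘ ψᵢ`, `ψᵢ(y) = (Tᵢ(y), ξᵢ(Tᵢ(y)) + Sᵢ(Tᵢ(y)) z̲′(y))` with `z′ = (Λᵢ^f)⁻¹ y`, `Sᵢ(t)z̲′ = spatial(Λ̃ᵢ(t)w)`,
`w = (0,z̲′) − ([Λ̃ᵢ(t)(0,z̲′)]⁰/uᵢ⁰)e₀`, `Tᵢ(y) = T₀(τ) + [Λ̃ᵢ(T₀(τ))(0,z̲′)]⁰`, `dT₀/dτ = uᵢ⁰(T₀)`: by construction the chart's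
Kerr–Schild radius equals the PAINTED radius `rᵢ(x) = r(Λ̃ᵢ(x⁰)⁻¹(0, x̲ − ξᵢ(x⁰)))` exactly, so `{r = r₊}` is the painted horizon,
which the hypothesis' exhaustion clause has already normalised to `∂I⁻(A)` at late times (no event-horizon regularity lemma);
`Λ̃ᵢ(T)⁻¹dψᵢ − (Λᵢ^f)⁻¹ → 0` in `C²` on truncated slabs by slaving (errors `ξ̇−v`, `Λ̃̇ z̲′`, `u⁰(T₀)−u⁰(T)` and two derivatives),
Kerr stationarity absorbs the rest-time shift, other holes contribute `O(Mⱼ/Dᵢⱼ) → 0`, `ψᵢ^*h → 0` (`ψᵢ ∈ C³` bounded); radial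
compression beyond `2Rᵢ(τ)` keeps `Ψᵢ` an open embedding into `Φ(late exterior) ⊆ O` away from the other holes; flat chart
`:= Φ` off thin tubes, excision `ρᵢ(t) := 2γ̄(|ξᵢ(t) − Vᵢt| + Rᵢ(t)) = o(t)` by Cesàro; `O′ := exteriorOf 𝒟 d.charted`,
`τ₀`-shift and exhaustion transported from the lab-slab clause (`N = 0` verbatim = `Theorems.inertialRecession_noHoles`;
`N = 1` static = `Theorems.inertialRecession_staticHole`). Size XL. Why it might fail: the lab-slab → tilted-slab exhaustion
transfer near `r₊` (forward timelike flow inside the tube; `Literature.Barriers.FinalStateConjecture.adaptedField_timelike`)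
and injectivity of the compressed map on the whole late boosted exterior. -/
theorem stub_rechart : ∀ (X : Type) [TopologicalSpace X] [ChartedSpace E3 X] [IsManifold (𝓡 3) ((⊤ : ℕ∞) : WithTop ℕ∞) X] [T2Space X] [SecondCountableTopology X] [ConnectedSpace X], ∀ D ∈ admissibleVacuumData X, ∀ 𝒟 : VacuumCauchyDevelopment D, 𝒟.IsMaximal → ∀ (N : ℕ) (M a rin : Fin N → ℝ) (Λ : Fin N → ℝ → lorentzGroup) (ξ : Fin N → ℝ → E3) (γ κ τ₀ : ℝ) (U : Opens E4) (Φ : U → 𝒟.carrier) (O : Set 𝒟.carrier), ((∀ i, Kerr.IsSubextremal (M i) (a i) ∧ Kerr.rMinus (M i) (a i) < rin i ∧ rin i < Kerr.rPlus (M i) (a i)) ∧ (∀ i t, |((Λ i t : E4 ≃L[ℝ] E4) (E4.basisVector 0)) 0| ≤ γ) ∧ (∀ i, ContDiff ℝ ((⊤ : ℕ∞) : WithTop ℕ∞) (ξ i) ∧ ContDiff ℝ ((⊤ : ℕ∞) : WithTop ℕ∞) (fun t ↦ ((Λ i t : E4 ≃L[ℝ] E4) : E4 →L[ℝ] E4)))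 ∧ (∀ i j, i ≠ j → Tendsto (fun t ↦ ‖ξ i t - ξ j t‖) atTop atTop) ∧ (0 < κ ∧ κ < 1 ∧ ∀ i, ∀ᶠ t in atTop, ‖ξ i t‖ ≤ κ ^ 2 * t) ∧ ({x : E4 | τ₀ < x 0 ∧ ∀ i, rin i < Kerr.radius (a i) (poincareInv (Λ i (x 0)) (E4.ofTimeSpace (x 0) (ξ i (x 0))) x)} ⊆ (U : Set E4)) ∧ let B : ModelBackground := ⟨U, fun x ↦ Minkowski.bilin + ∑ i, (boostedKerrBilin (Λ i (x 0)) (E4.ofTimeSpace (x 0) (ξ i (x 0))) (M i) (a i) x - Minkowski.bilin), fun x ↦ x 0, E4.spatialNorm⟩; ContMDiff 𝓘(ℝ, E4) (𝓡 4) ((⊤ : ℕ∞) : WithTop ℕ∞) Φ ∧ Topology.IsOpenEmbedding ((B.lateRegion τ₀).restrict Φ) ∧ Φ '' {x : U | τ₀ < x.1 0 ∧ ∀ i, Kerr.rPlus (M i) (a i) < Kerr.radius (a i) (poincareInv (Λ i (x.1 0)) (E4.ofTimeSpace (x.1 0) (ξ i (x.1 0))) x.1)} ⊆ O ∧ Tendsto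 (fun t ↦ 𝒟.toSpacetime.deviationCk B Φ 3 t) atTop (𝓝 0) ∧ Tendsto (fun t : ℝ ↦ ⨆ x ∈ {x : U | x.1 0 = t ∧ E4.spatialNorm x.1 ≤ κ * t}, ⨆ (m : ℕ) (_ : m ≤ 3), ENNReal.ofReal (1 + √(√((⨅ i, ‖E4.spatial x.1 - ξ i t‖) ^ 7))) * ‖iteratedFDeriv ℝ m (𝒟.toSpacetime.deviationExtend B Φ) x.1‖ₑ) atTop (𝓝 0) ∧ O = Summit.FinalStateConjecture.exteriorOf 𝒟.toCauchyDevelopment (Φ '' {x : U | τ₀ < x.1 0 ∧ ∀ i, Kerr.rPlus (M i) (a i) < Kerr.radius (a i) (poincareInv (Λ i (x.1 0)) (E4.ofTimeSpace (x.1 0) (ξ i (x.1 0))) x.1)}) ∧ ∀ t₁ : ℝ, τ₀ < t₁ → O \ Φ '' {x : U | t₁ < x.1 0 ∧ ∀ i, Kerr.rPlus (M i) (a i) < Kerr.radius (a i) (poincareInv (Λ i (x.1 0)) (E4.ofTimeSpace (x.1 0) (ξ i (x.1 0))) x.1)} ⊆ 𝒟.metric.causalPast 𝒟.timeOrientation (Φ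 '' {x : U | x.1 0 = t₁ ∧ ∀ i, Kerr.rPlus (M i) (a i) < Kerr.radius (a i) (poincareInv (Λ i (x.1 0)) (E4.ofTimeSpace (x.1 0) (ξ i (x.1 0))) x.1)})) →
    (∀ i : Fin N, (∀ m : ℕ, 1 ≤ m → m ≤ 3 → Tendsto (fun t ↦ iteratedDeriv m (fun s ↦ (((Λ i s : lorentzGroup) : E4 ≃L[ℝ] E4) (E4.basisVector 0))) t) atTop (𝓝 0)) ∧ (∀ m : ℕ, m ≤ 2 → Tendsto (fun t ↦ iteratedDeriv m (fun s ↦ deriv (ξ i) s - (((((Λ i s : lorentzGroup) : E4 ≃L[ℝ] E4) (E4.basisVector 0)) 0)⁻¹ • E4.spatial (((Λ i s : lorentzGroup) : E4 ≃L[ℝ] E4) (E4.basisVector 0)))) t) atTop (𝓝 0)) ∧ (a i ≠ 0 → ∀ m : ℕ, 1 ≤ m → m ≤ 3 → Tendsto (fun t ↦ iteratedDeriv m (fun s ↦ (((Λ i s : lorentzGroup) : E4 ≃L[ℝ] E4) (E4.basisVector 3))) t) atTop (𝓝 0))) →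
    (∀ i : Fin N, ∃ V : E3, Tendsto (fun t : ℝ ↦ t⁻¹ • ξ i t) atTop (𝓝 V)) →
    ∃ (O : Set 𝒟.carrier) (d : FinalStateDecomposition 𝒟.toSpacetime O 2), (∀ i, Kerr.IsSubextremal (d.mass i) (d.spin i)) ∧ O = Summit.FinalStateConjecture.exteriorOf 𝒟.toCauchyDevelopment d.charted ∧ Summit.FinalStateConjecture.HasExhaustiveCharts d := by
  sorry

/-! ## The composition (kernel-checked; concludes the crux BY NAME) -/

/-- `InertialRecession` from the seven stubs: slaving ⇒ quasi-stationarity ⇒ (pseudotensor bound ⇒ window charges ⇒)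
charge model of the lab metric ⇒ Cesàro velocities (endgame, with the kinematic clauses of the antecedent) ⇒ re-charting.
Pure logic; every `sorry` lives in a `stub_*`. -/
theorem InertialRecession_of : InertialRecession := by
  intro X _ _ _ _ _ _ D hD 𝒟 h𝒟 hyp
  obtain ⟨N, M, a, rin, Λ, ξ, γ, κ, τ₀, U, Φ, O, hL⟩ := hyp
  obtain ⟨hS, hcont, hk⟩ := stub_slaving X D hD 𝒟 h𝒟 N M a rin Λ ξ γ κ τ₀ U Φ O hL
  have hQ := stub_quasiStationarity X D hD 𝒟 h𝒟 N M a rin Λ ξ γ κ τ₀ U Φ O hL hS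
  obtain ⟨hW, hI⟩ := stub_chargeModel (stub_windowCharges stub_pseudotensorBound)
    X D hD 𝒟 h𝒟 N M a rin Λ ξ γ κ τ₀ U Φ O hL hS hQ
  -- kinematic clauses of the antecedent consumed by the endgame
  have hM : ∀ i, 0 < M i := fun i ↦ (abs_nonneg (a i)).trans_lt (hL.1 i).1
  have hκ : 0 < κ ∧ κ < 1 ∧ ∀ i, ∀ᶠ t in atTop, ‖ξ i t‖ ≤ κ ^ 2 * t := hL.2.2.2.2.1
  have hsep : ∀ i j, i ≠ j → Tendsto (fun t ↦ ‖ξ i t - ξ j t‖) atTop atTop := hL.2.2.2.1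
  have hsmooth : ∀ i, ContDiff ℝ ((⊤ : ℕ∞) : WithTop ℕ∞) (ξ i) := fun i ↦ (hL.2.2.1 i).1
  have hmis : ∀ i, Tendsto (fun t ↦ deriv (ξ i) t -
      ((((Λ i t : lorentzGroup) : E4 ≃L[ℝ] E4) (E4.basisVector 0)) 0)⁻¹ •
        E4.spatial (((Λ i t : lorentzGroup) : E4 ≃L[ℝ] E4) (E4.basisVector 0))) atTop (𝓝 0) := fun i ↦ by
    simpa using (hS i).2.1 0 (Nat.zero_le 2)
  obtain ⟨k, hk0, hk1, hkb⟩ := hk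
  have hC := stub_cesaroEndgame N M ξ _ κ _ hM hκ.1 hκ.2.1 hsmooth hκ.2.2 hsep hcont
    ⟨k, hk0, hk1, fun i t ↦ hkb i t⟩ hmis hW hI
  exact stub_rechart X D hD 𝒟 h𝒟 N M a rin Λ ξ γ κ τ₀ U Φ O hL hS hC

/-! ## Kernel checks against the landed Negative lemmas (documentation; no stubs involved) -/

section NegativeChecks

open Summit.FinalStateConjecture.FinalStateConjecture.Theorems.InertialRecession.Negative

/-- The stabiliser twist of `PaintingRigidityStabiliser` fixes `e₀`… -/
example (θ : ℝ) : rotCLM θ (E4.basisVector 0) = E4.basisVector 0 := rotCLM_basisVector_zero θ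

/-- …and `e₃` (the spin axis): -/
example (θ : ℝ) : rotCLM θ (E4.basisVector 3) = E4.basisVector 3 := by
  ext k; fin_cases k <;> simp

/-- …hence the data the slaving stub speaks about are twist-invariant: `(Λ·R_θ) e₀ = Λ e₀`, `(Λ·R_θ) e₃ = Λ e₃`. -/
example (Λ : lorentzGroup) (θ : ℝ) :
    ((Λ * rotL θ : lorentzGroup) : E4 ≃L[ℝ] E4) (E4.basisVector 0) = (Λ : E4 ≃L[ℝ] E4) (E4.basisVector 0) := by
  rw [mul_rotL_apply, rotCLM_basisVector_zero]

example (Λ : lorentzGroup) (θ : ℝ) :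
    ((Λ * rotL θ : lorentzGroup) : E4 ≃L[ℝ] E4) (E4.basisVector 3) = (Λ : E4 ≃L[ℝ] E4) (E4.basisVector 3) := by
  have h : rotCLM θ (E4.basisVector 3) = E4.basisVector 3 := by ext k; fin_cases k <;> simp
  rw [mul_rotL_apply, h]

/-- The kinematic witness of `KinematicShadow` is not frozen; the line never derives a velocity statement from kinematics. -/
example : ¬ InertialRecessionWithoutFieldEquations := inertialRecession_false_without_fieldEquations

end NegativeChecks

end Summit.FinalStateConjecture.FinalStateConjecture.Cruxes.InertialRecession.SublinearIsFreeCleanWindowCharges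

end
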